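import Literature.NumberTheory.EllipticCurves.FunctionFieldEllipticLHeightsProofs
import Literature.NumberTheory.EllipticCurves.FunctionFieldPlacesGenusProofs
import Literature.NumberTheory.EllipticCurves.FunctionFieldPlaceDegreesProofs
import Literature.NumberTheory.EllipticCurves.FunctionFieldPlacesResidueCardProofs
import Literature.NumberTheory.DiophantineGeometry.FunctionFieldDivisorsAdicProofs
import Literature.NumberTheory.DiophantineGeometry.FunctionFieldGenusRiemannRochProofs
import Literature.NumberTheory.DiophantineGeometry.FunctionFieldGenusApproximationProofs
import Mathlib.Data.Finsupp.Interval
import Mathlib.Order.Northcott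
import HarnessLib

/-!
# Northcott's finiteness for the naive height on `E(F)` over a global function field

A *proofs* file (theorems only; D-0014/D-0026) of the provefact seat (approach B) of
`Literature.NumberTheory.EllipticCurves.analyticRank_eq_iff_finite_sha` (bsd.S33), supplying the
last missing input of the Mordell–Weil–Lang–Néron theorem over global function fields
(Silverman, *AEC*, VIII.3.1 hypothesis (iii); Ulmer (2011), Lecture 1, Thm. 5.1 and Lecture 3,
§§3–4, "one can then introduce a theory of heights exactly as in [AEC] and use it to finish the
proof"): for the naive height `h(x, y) = log q · deg (x)_∞ = log q · ∑_v max(0, -ord_v x) deg v`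
of `FunctionFieldEllipticL` (`naiveHeight q W`),

* `finite_setOf_finsum_pole_le` — for every `B`, the elements `x` of a global function field
  `F ⊇ 𝔽_q(t)` whose polar divisor has degree `≤ B` form a finite set. Proof: such an `x ≠ 0`
  lies in the Riemann–Roch space `L((x)_∞)` of its polar divisor (Stichtenoth Def. I.4.4; the
  tree's `mem_riemannRochSpace_iff_ord_holds`), which is finite (finite-dimensional over the
  finite field `𝔽_q`: Stichtenoth Prop. I.4.9, the tree's
  `finiteDimensional_riemannRochSpace_holds`), and `(x)_∞` runs over the finite set of effective
  divisors supported on the finitely many places of degree `≤ B` (Rosen Lemma 5.5, the tree's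
  `finite_placesOfDegree_holds`) with multiplicities `≤ B`. The two notions of place in the tree
  (`Place F` of the elliptic-curve files, `PlaceOver 𝔽_q F` of the Riemann–Roch files) are
  matched by the bijection `PlaceOver.toPlace` (`toPlace_bijective_holds`), under which `ord_v`
  is literally the same function (`ord_toPlace`).
* `finite_setOf_naiveHeight_le`, `northcott_naiveHeight` — **Northcott's theorem for `E(F)`**:
  `{P ∈ E(F) | h(P) ≤ C}` is finite for every `C` (Silverman, *AEC*, VIII.6.1 remark /
  Thm. VIII.5.11 for number fields; over function fields e.g. Ulmer (2011), Lecture 3, §3),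
  since over each `x` lie at most two points.

## References

* [SilvermanAEC2009] J. H. Silverman, *The Arithmetic of Elliptic Curves*, 2nd ed. (2009),
  Thm. VIII.3.1 (iii), Prop. VIII.6.1 (remark), Thm. VIII.5.11.
* [Ulmer2011ParkCity] D. Ulmer, *Elliptic curves over function fields*, IAS/Park City Math.
  Ser. 18 (2011), Lecture 1, Thm. 5.1; Lecture 3, §§3–4.
* [Stichtenoth2009] H. Stichtenoth, *Algebraic Function Fields and Codes*, 2nd ed. (2009),
  Def. I.4.4, Prop. I.4.9.
* [RosenFunctionFields2002] M. Rosen, *Number Theory in Function Fields* (2002), Lemma 5.5.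
-/

noncomputable section

open scoped Classical Polynomial

namespace Literature.NumberTheory.EllipticCurves.FunctionField

open DiophantineGeometry DiophantineGeometry.AlgFunctionField

/-! ## Matching the two notions of place -/

section Bridge

variable {Fq : Type} [Field Fq] {F : Type} [Field F] [Algebra Fq F]

/-- `ord_v` is the same function for a place over `𝔽_q` and its underlying place of `F`
(both are the normalised valuation of the common valuation ring). [folklore] -/
theorem ord_toPlace (w : PlaceOver Fq F) (x : F) : (PlaceOver.toPlace w).ord x = w.ord x :=
  rfl

end Bridge

/-! ## A single term is bounded by a nonnegative `finsum` -/

/-- For a nonnegative finitely supported function, each value is at most the `finsum`.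
[folklore] -/
theorem le_finsum_of_nonneg {ι : Type*} {f : ι → ℤ} (hf : ∀ i, 0 ≤ f i)
    (hs : (Function.support f).Finite) (i : ι) : f i ≤ ∑ᶠ j, f j := by
  rw [finsum_eq_sum_of_support_subset f (s := hs.toFinset) (by simp)]
  by_cases hi : i ∈ hs.toFinset
  · exact Finset.single_le_sum (fun j _ => hf j) hi
  · have : f i = 0 := by simpa using hi
    rw [this]
    exact Finset.sum_nonneg fun j _ => hf j

/-! ## Elements with polar divisor of bounded degree -/

section PolarDegree

variable (Fq F : Type) [Field Fq] [Fintype Fq] [Field F] [Algebra Fq[X] F]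
  [Algebra (RatFunc Fq) F] [IsScalarTower Fq[X] (RatFunc Fq) F] [FunctionField Fq F]

/-- **Finitely many functions with polar divisor of bounded degree.** In a global function field
`F ⊇ 𝔽_q(t)`, for every `B` the set of `x ∈ F` with
`deg (x)_∞ = ∑_v max(0, -ord_v x) · deg v ≤ B` is finite: each such `x ≠ 0` lies in the
Riemann–Roch space of its polar divisor, a finite-dimensional `𝔽_q`-space (Stichtenoth
Prop. I.4.9), and the polar divisor lies in the finite set of effective divisors supported on
the places of degree `≤ B` (Rosen Lemma 5.5) with multiplicities `≤ B`.
[cite: Stichtenoth2009, Def. I.4.4 and Prop. I.4.9] -/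
theorem finite_setOf_finsum_pole_le (B : ℕ) :
    {x : F | ∑ᶠ v : Place F, max 0 (-(v.ord x)) * (v.degree (Fintype.card Fq) : ℤ) ≤ B}.Finite := by
  letI : Algebra Fq F := ((algebraMap Fq[X] F).comp Polynomial.C).toAlgebra
  haveI : IsScalarTower Fq Fq[X] F := IsScalarTower.of_algebraMap_eq fun c => by
    rw [RingHom.algebraMap_toAlgebra, RingHom.comp_apply, Polynomial.C_eq_algebraMap]
  haveI : IsAlgFunctionField Fq F := isAlgFunctionField_of_functionField Fq F
  set q := Fintype.card Fq with hq
  have hbij : Function.Bijective (PlaceOver.toPlace (Fq := Fq) (F := F)) :=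
    PlaceOver.toPlace_bijective_holds
  -- the finitely many places of degree `≤ B`
  set S : Set (PlaceOver Fq F) := {w | (PlaceOver.toPlace w).degree q ≤ B} with hSdef
  have hS : S.Finite := by
    have h1 : (⋃ d ∈ (Finset.range (B + 1) : Set ℕ), placesOfDegree Fq F d).Finite :=
      Set.Finite.biUnion (Finset.finite_toSet _) fun d _ => finite_placesOfDegree_holds Fq F d
    refine (h1.preimage hbij.1.injOn).subset fun w hw => ?_
    simp only [Set.mem_preimage, Set.mem_iUnion, Finset.coe_range, Set.mem_Iio, exists_prop]
    exact ⟨_, Nat.lt_succ_of_le hw, rfl⟩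
  -- the bounding divisor `G = B · ∑_{w ∈ S} w`
  let G : Divisor Fq F :=
    Finsupp.onFinset hS.toFinset (fun w => if w ∈ S then (B : ℤ) else 0) fun w hw => by
      by_contra h
      rw [Set.Finite.mem_toFinset] at h
      exact hw (if_neg h)
  have hG : ∀ w, G w = if w ∈ S then (B : ℤ) else 0 := fun w => Finsupp.onFinset_apply
  -- every Riemann–Roch space is finite
  have hL : ∀ D : Divisor Fq F, ((riemannRochSpace D : Submodule Fq F) : Set F).Finite := by
    intro D
    haveI : FiniteDimensional Fq (riemannRochSpace D) := finiteDimensional_riemannRochSpace_holds D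
    haveI : Finite (riemannRochSpace D) := Module.finite_of_finite Fq
    exact Set.toFinite _
  have hT : (({0} : Set F) ∪ ⋃ D ∈ Set.Icc (0 : Divisor Fq F) G,
      ((riemannRochSpace D : Submodule Fq F) : Set F)).Finite :=
    (Set.finite_singleton 0).union ((Set.finite_Icc 0 G).biUnion fun D _ => hL D)
  refine hT.subset fun x hx => ?_
  rw [Set.mem_setOf_eq] at hx
  by_cases hx0 : x = 0
  · exact Or.inl hx0
  right
  -- the polar divisor of `x`
  have hfin : {w : PlaceOver Fq F | w.ord x ≠ 0}.Finite := finite_setOf_ord_ne_zero_holds hx0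
  let Dx : Divisor Fq F := Finsupp.ofSupportFinite (fun w => max 0 (-(w.ord x)))
    (hfin.subset fun w hw => by
      rw [Function.mem_support] at hw
      rw [Set.mem_setOf_eq]
      intro h0
      rw [h0, neg_zero, max_self] at hw
      exact hw rfl)
  have hDx : ∀ w, Dx w = max 0 (-(w.ord x)) := fun w => rfl
  -- support of the summand and the termwise bound
  have hsupp : (Function.support fun v : Place F =>
      max 0 (-(v.ord x)) * (v.degree q : ℤ)).Finite := by
    refine (Place.finite_setOf_ord_ne_zero Fq F hx0).subset fun v hv => ?_
    rw [Function.mem_support] at hv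
    rw [Set.mem_setOf_eq]
    intro h0
    rw [h0, neg_zero, max_self, zero_mul] at hv
    exact hv rfl
  have hterm : ∀ w : PlaceOver Fq F,
      max 0 (-(w.ord x)) * ((PlaceOver.toPlace w).degree q : ℤ) ≤ B := fun w =>
    (le_finsum_of_nonneg (fun v => mul_nonneg (le_max_left _ _) (Int.natCast_nonneg _)) hsupp
      (PlaceOver.toPlace w)).trans hx
  refine Set.mem_biUnion (x := Dx) ⟨?_, ?_⟩ ?_
  · exact Finsupp.le_def.mpr fun w => by rw [hDx]; exact le_max_left _ _
  · refine Finsupp.le_def.mpr fun w => ?_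
    rw [hDx, hG]
    by_cases hord : 0 ≤ w.ord x
    · rw [max_eq_left (neg_nonpos.mpr hord)]
      split_ifs <;> exact_mod_cast Nat.zero_le _
    · have hpos : 0 < -(w.ord x) := by omega
      have hdeg : (1 : ℤ) ≤ ((PlaceOver.toPlace w).degree q : ℤ) := by
        exact_mod_cast Place.degree_pos_of_finiteDimensional Fq (PlaceOver.toPlace w)
      have ht := hterm w
      rw [max_eq_right hpos.le] at ht ⊢
      have hwS : w ∈ S := by
        change (PlaceOver.toPlace w).degree q ≤ B
        have : ((PlaceOver.toPlace w).degree q : ℤ) ≤ B := (le_mul_of_one_le_left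
          (Int.natCast_nonneg _) (by omega)).trans ht
        exact_mod_cast this
      rw [if_pos hwS]
      nlinarith
  · change x ∈ riemannRochSpace Dx
    rw [mem_riemannRochSpace_iff_ord_holds Dx hx0]
    intro w
    rw [hDx]
    omega

end PolarDegree

/-! ## Northcott's theorem for the naive height on `E(F)` -/

section Northcott

variable (Fq : Type) {F : Type} [Field Fq] [Fintype Fq] [Field F] [Algebra Fq[X] F]
  [Algebra (RatFunc Fq) F] [IsScalarTower Fq[X] (RatFunc Fq) F] [FunctionField Fq F]
  (W : WeierstrassCurve F)

/-- Over one abscissa `x` lie finitely many (at most two) points of `E(F)`. [folklore] -/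
theorem finite_setOf_point_X_eq (x : F) :
    {P : W.toAffine.Point | ∃ (y : F) (h : W.toAffine.Nonsingular x y),
      P = WeierstrassCurve.Affine.Point.some x y h}.Finite := by
  by_cases hex : ∃ y₀, W.toAffine.Equation x y₀
  · obtain ⟨y₀, hy₀⟩ := hex
    have hY : {y : F | W.toAffine.Equation x y} ⊆ {y₀, W.toAffine.negY x y₀} := fun y hy =>
      WeierstrassCurve.Affine.Y_eq_of_X_eq hy hy₀ rfl
    have hYfin : {y : F | W.toAffine.Equation x y}.Finite :=
      ((Set.finite_singleton _).insert y₀).subset hY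
    refine (hYfin.image fun y => if h : W.toAffine.Nonsingular x y then
      (WeierstrassCurve.Affine.Point.some x y h : W.toAffine.Point) else 0).subset ?_
    rintro P ⟨y, h, rfl⟩
    exact ⟨y, h.left, by simp only [h, dite_true]⟩
  · convert Set.finite_empty
    ext P
    simp only [Set.mem_setOf_eq, Set.mem_empty_iff_false, iff_false, not_exists]
    intro y h _
    exact hex ⟨y, h.left⟩

include Fq in
/-- **Northcott's theorem for `E(F)` over a global function field**: for the naive height
`h(P) = log q · deg (x(P))_∞` (`naiveHeight q W`, `q = #𝔽_q`) and every real `C`, the set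
`{P ∈ E(F) | h(P) ≤ C}` is finite — the abscissae have polar degree `≤ C / log q`
(`finite_setOf_finsum_pole_le`) and over each lie at most two points. This is hypothesis (iii)
of the descent theorem (Silverman, *AEC*, Thm. VIII.3.1) for `E(F)`.
[cite: SilvermanAEC2009, Thm. VIII.3.1 (iii) and Prop. VIII.6.1]
[cite: Ulmer2011ParkCity, Lecture 3, §3] -/
theorem finite_setOf_naiveHeight_le (C : ℝ) :
    {P : W.toAffine.Point | naiveHeight (Fintype.card Fq) W P ≤ C}.Finite := by
  set q := Fintype.card Fq with hq
  have hq1 : 1 < q := Fintype.one_lt_card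
  have hlog : 0 < Real.log q := Real.log_pos (by exact_mod_cast hq1)
  set B : ℕ := Int.toNat ⌊C / Real.log q⌋ with hB
  have hX := finite_setOf_finsum_pole_le Fq F B
  have hT : (({0} : Set W.toAffine.Point) ∪
      ⋃ x ∈ {x : F | ∑ᶠ v : Place F, max 0 (-(v.ord x)) * (v.degree q : ℤ) ≤ B},
        {P : W.toAffine.Point | ∃ (y : F) (h : W.toAffine.Nonsingular x y),
          P = WeierstrassCurve.Affine.Point.some x y h}).Finite :=
    (Set.finite_singleton 0).union (hX.biUnion fun x _ => finite_setOf_point_X_eq W x)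
  refine hT.subset fun P hP => ?_
  rw [Set.mem_setOf_eq] at hP
  rcases P with _ | ⟨x, y, h⟩
  · exact Or.inl rfl
  right
  refine Set.mem_biUnion (x := x) ?_ ⟨y, h, rfl⟩
  rw [Set.mem_setOf_eq]
  -- unfold the height of an affine point
  change Real.log q * ∑ᶠ v : Place F,
    ((max 0 (-(v.ord x)) * (v.degree q : ℤ) : ℤ) : ℝ) ≤ C at hP
  have hx0 : x ≠ 0 ∨ x = 0 := (eq_or_ne x 0).symm
  have hsupp : (Function.support fun v : Place F =>
      max 0 (-(v.ord x)) * (v.degree q : ℤ)).Finite := by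
    rcases eq_or_ne x 0 with rfl | hx
    · refine Set.finite_empty.subset fun v hv => ?_
      rw [Function.mem_support] at hv
      exact hv (by rw [Place.ord]; simp)
    · refine (Place.finite_setOf_ord_ne_zero Fq F hx).subset fun v hv => ?_
      rw [Function.mem_support] at hv
      rw [Set.mem_setOf_eq]
      intro h0
      rw [h0, neg_zero, max_self, zero_mul] at hv
      exact hv rfl
  have hcast : ∑ᶠ v : Place F, ((max 0 (-(v.ord x)) * (v.degree q : ℤ) : ℤ) : ℝ) =
      ((∑ᶠ v : Place F, max 0 (-(v.ord x)) * (v.degree q : ℤ) : ℤ) : ℝ) :=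
    ((Int.castAddHom ℝ).map_finsum hsupp).symm
  rw [hcast] at hP
  have hle : ((∑ᶠ v : Place F, max 0 (-(v.ord x)) * (v.degree q : ℤ) : ℤ) : ℝ) ≤
      C / Real.log q := by
    rw [le_div_iff₀ hlog, mul_comm]
    exact hP
  have hfloor : ∑ᶠ v : Place F, max 0 (-(v.ord x)) * (v.degree q : ℤ) ≤ ⌊C / Real.log q⌋ :=
    Int.le_floor.mpr hle
  calc ∑ᶠ v : Place F, max 0 (-(v.ord x)) * (v.degree q : ℤ) ≤ ⌊C / Real.log q⌋ := hfloor
    _ ≤ (B : ℤ) := Int.self_le_toNat _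

include Fq in
/-- The naive height on `E(F)` over a global function field is a Northcott function
(Mathlib's `Northcott`). [cite: SilvermanAEC2009, Thm. VIII.3.1 (iii)] -/
theorem northcott_naiveHeight : Northcott (naiveHeight (Fintype.card Fq) W) :=
  ⟨fun C => finite_setOf_naiveHeight_le Fq W C⟩

end Northcott

end Literature.NumberTheory.EllipticCurves.FunctionField

end
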